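import Summits.QuantumFields.YangMills.Theorems.UnitScaleTiltSmoothLiftLoopSum
import Literature.MathematicalPhysics.QuantumFieldTheory.Balaban1983to89.BlockAveragingEMLHaarAC
import HarnessLib

/-!
# Route `UnitScaleTilt`, crux K1 child «MinimiserStabilityRegPr» (stmt-QuantumFields-19200), stub `stub_smoothLift` (G-K1a-2′) — helper P3d₁:
# SIZES OF THE LOOP EXPONENTS OF THE SMOOTH INTERPOLATION, AND ITS STRAIGHT TRANSPORTERS

Fleet seat `ym-ust-19200-p2` (gen 0).  Two inputs of the consistency `‖V(c) − avg(interp V)(c)‖ = O(|F|² + |∇F|)` (next file):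
§1 every exponent read along a word inside the cube is `≤ d·h·M_F/(2L²)` (`norm_mem_stepExps_le`), and runs along an axis read zeros
(`stepExps_axis`: the potential vanishes on the axis); §2 **`axialAvg_interp`**: the straight transporter of `interp V` along `c` IS `V(c)`
(`1,…,1,V(c),1,…,1` along the line: the central bond carries `V(c)`, `UnitScaleTiltSmoothLiftLoopSplit.coe_interp_central`).
[cite: Balaban1987RG1, (0.4) p.253; Balaban1984PropagatorsI, (1.7) p.18]
-/

noncomputable section

open scoped Matrix.Norms.L2Operator BigOperators

namespace Summit.QuantumFields.YangMills.Theorems.SmoothLiftInterp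

open Literature.MathematicalPhysics.QuantumFieldTheory.Balaban1983to89
open MatrixLog T4Continuum AveragingRT BlockAveraging BlockAveragingSection BlockAveragingSectionPlaq NormedSpace ExpMeanLog
open BlockAveragingEMLHaarAC (coe_avg_expMeanLogSU)

variable {P : Params} {j : ℕ}

/-! ## §1 Sizes of the exponents -/

section Sizes

variable (P) in
/-- `potAt` of the zero tensor vanishes. [folklore] -/
theorem potAt_zero_tensor (e : Fin P.d → ℤ) (μ : Fin P.d) : potAt P (fun _ _ => (0 : Matrix (Fin 2) (Fin 2) ℂ)) e μ = 0 := by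
  unfold potAt; simp

variable (P) in
/-- `‖potAt F e λ‖ ≤ d·M·M_F/(2L²)` for `|e_ρ| ≤ M`, `‖F_{ρλ}‖ ≤ M_F`. [folklore] -/
theorem norm_potAt_le (F : Fin P.d → Fin P.d → Matrix (Fin 2) (Fin 2) ℂ) {M M_F : ℝ} (hM : 0 ≤ M) (hF : ∀ ρ μ, ‖F ρ μ‖ ≤ M_F)
    {e : Fin P.d → ℤ} (he : ∀ ν, |((e ν : ℤ) : ℝ)| ≤ M) (μ : Fin P.d) : ‖potAt P F e μ‖ ≤ (P.d : ℝ) * M * M_F / (2 * (P.L : ℝ) ^ 2) := by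
  have h := norm_potAt_sub_le P F (fun _ _ => 0) hM (fun ρ μ => by rw [sub_zero]; exact hF ρ μ) he μ
  rwa [potAt_zero_tensor, sub_zero] at h

variable (P) in
/-- **EVERY EXPONENT ALONG A WORD INSIDE THE CUBE IS SMALL**: `‖X‖ ≤ d·h·M_F/(2L²)` for `X ∈ stepExps F e w` when all prefix positions have
`|·| ≤ h` and `‖F‖ ≤ M_F`. [folklore] -/
theorem norm_mem_stepExps_le (F : Fin P.d → Fin P.d → Matrix (Fin 2) (Fin 2) ℂ) {M M_F : ℝ} (hM : 0 ≤ M) (hF : ∀ ρ μ, ‖F ρ μ‖ ≤ M_F) :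
    ∀ (w : List (Letter P.d)) (e : Fin P.d → ℤ),
    (∀ (k : ℕ) (ν : Fin P.d), |((e ν + netDisp (w.take k) ν : ℤ) : ℝ)| ≤ M) →
    ∀ X ∈ stepExps P F e w, ‖X‖ ≤ (P.d : ℝ) * M * M_F / (2 * (P.L : ℝ) ^ 2)
  | [], e, _, X, hX => by simp at hX
  | (μ, b) :: w, e, hbox, X, hX => by
    have he : ∀ ν, |((e ν : ℤ) : ℝ)| ≤ M := fun ν => by have h := hbox 0 ν; simpa [netDisp] using h
    cases b
    · have he' : ∀ ν, |(((e - Pi.single μ 1 : Fin P.d → ℤ) ν : ℤ) : ℝ)| ≤ M := fun ν => by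
        have h := hbox 1 ν
        rw [netDisp_take_succ_cons] at h
        simp only [List.take_zero, Bool.false_eq_true, if_false] at h
        have h0 : netDisp ([] : List (Letter P.d)) ν = 0 := by simp [netDisp]
        rw [h0, add_zero] at h
        rw [Pi.sub_apply, Pi.single_apply]
        by_cases hν : ν = μ
        · subst hν; simp only [if_true] at h ⊢; rwa [sub_eq_add_neg]
        · simp only [if_neg hν, if_neg (Ne.symm hν), add_zero, sub_zero] at h ⊢; exact h
      have htail : ∀ (k : ℕ) (ν : Fin P.d), |(((e - Pi.single μ 1 : Fin P.d → ℤ) ν + netDisp (w.take k) ν : ℤ) : ℝ)| ≤ M := fun k ν => by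
        have h := hbox (k + 1) ν
        rw [netDisp_take_succ_cons] at h
        rw [Pi.sub_apply, Pi.single_apply]
        by_cases hν : ν = μ
        · subst hν; simp only [if_true, Bool.false_eq_true, if_false] at h ⊢; rwa [sub_eq_add_neg, add_assoc]
        · simp only [if_neg hν, if_neg (Ne.symm hν), zero_add, sub_zero] at h ⊢; exact h
      rw [stepExps_cons_false, List.mem_cons] at hX
      rcases hX with rfl | hX
      · rw [norm_neg]; exact norm_potAt_le P F hM hF he' μ
      · exact norm_mem_stepExps_le F hM hF w _ htail X hX
    · have htail : ∀ (k : ℕ) (ν : Fin P.d), |(((e + Pi.single μ 1 : Fin P.d → ℤ) ν + netDisp (w.take k) ν : ℤ) : ℝ)| ≤ M := fun k ν => by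
        have h := hbox (k + 1) ν
        rw [netDisp_take_succ_cons] at h
        rw [Pi.add_apply, Pi.single_apply]
        by_cases hν : ν = μ
        · subst hν; simp only [if_true] at h ⊢; rwa [add_assoc]
        · simp only [if_neg hν, if_neg (Ne.symm hν), zero_add, add_zero] at h ⊢; exact h
      rw [stepExps_cons_true, List.mem_cons] at hX
      rcases hX with rfl | hX
      · exact norm_potAt_le P F hM hF he μ
      · exact norm_mem_stepExps_le F hM hF w _ htail X hX

variable (P) in
/-- On the axis of direction `μ` a run reads only zeros (`F_{μμ} = 0`). [folklore] -/
theorem stepExps_axis (F : Fin P.d → Fin P.d → Matrix (Fin 2) (Fin 2) ℂ) {μ : Fin P.d} (hF : F μ μ = 0) (b : Bool) :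
    ∀ (t : ℕ) (e : Fin P.d → ℤ), (∀ ρ, ρ ≠ μ → e ρ = 0) →
      stepExps P F e (List.replicate t (μ, b)) = List.replicate t (0 : Matrix (Fin 2) (Fin 2) ℂ)
  | 0, e, _ => by simp
  | t + 1, e, he => by
    cases b
    · have he' : ∀ ρ, ρ ≠ μ → (e - Pi.single μ 1 : Fin P.d → ℤ) ρ = 0 := fun ρ hρ => by
        rw [Pi.sub_apply, Pi.single_apply, if_neg hρ, he ρ hρ, sub_zero]
      rw [List.replicate_succ, stepExps_cons_false, potAt_axis P F hF he', neg_zero, stepExps_axis F hF false t _ he', List.replicate_succ]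
    · have he' : ∀ ρ, ρ ≠ μ → (e + Pi.single μ 1 : Fin P.d → ℤ) ρ = 0 := fun ρ hρ => by
        rw [Pi.add_apply, Pi.single_apply, if_neg hρ, he ρ hρ, add_zero]
      rw [List.replicate_succ, stepExps_cons_true, potAt_axis P F hF he, stepExps_axis F hF true t _ he', List.replicate_succ]

/-- A product of exponentials of zeros is `1`. [folklore] -/
theorem prod_map_exp_replicate_zero (t : ℕ) :
    ((List.replicate t (0 : Matrix (Fin 2) (Fin 2) ℂ)).map exp).prod = 1 := by
  rw [List.map_replicate, exp_zero, List.prod_replicate, one_pow]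

end Sizes

/-! ## §2 The straight transporter of the interpolation is the coarse bond variable -/

section Axial

/-- **`axialAvg (interp V) = V`**: along the line of `c` the interpolation is `1, …, 1, V(c), 1, …, 1` (the potential vanishes on the
axis; the central bond carries `V(c)`). [cite: Balaban1984PropagatorsI, (1.7) p.18] -/
theorem axialAvg_interp (hj : j + 1 ≤ P.m + P.K) (V : GaugeField P (j+1) (Matrix.specialUnitaryGroup (Fin 2) ℂ)) (c : PBond P (j+1)) :
    axialAvg (interp V) c = V c := by
  letI : NormedAlgebra ℚ (Matrix (Fin 2) (Fin 2) ℂ) := NormedAlgebra.restrictScalars ℚ ℂ _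
  obtain ⟨y, μ⟩ := c
  apply Subtype.ext
  set hh : ℕ := (P.L - 1) / 2 with hhh
  have hL : P.L = 2 * hh + 1 := (two_mul_half_add_one P).symm
  have hsplit : List.replicate P.L ((μ, true) : Letter P.d) = List.replicate hh (μ, true) ++ ((μ, true) :: List.replicate hh (μ, true)) := by
    rw [← replicate_split]; congr 1; omega
  have h0b : ∀ ν, -(hh : ℤ) ≤ (0 : Fin P.d → ℤ) ν ∧ (0 : Fin P.d → ℤ) ν ≤ hh := fun ν => by simp only [Pi.zero_apply]; omega
  set z : Fin P.d → ℤ := Function.update (0 : Fin P.d → ℤ) μ (hh : ℤ) with hz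
  set g : Fin P.d → ℤ := Function.update (0 : Fin P.d → ℤ) μ (-(hh : ℤ)) with hg
  have hgb : ∀ ν, -(hh : ℤ) ≤ g ν ∧ g ν ≤ hh := fun ν => by
    rw [hg, Function.update_apply]; split_ifs <;> [omega; (rw [Pi.zero_apply]; omega)]
  have p1 : walkEnd (emb y) (List.replicate hh ((μ, true) : Letter P.d)) = siteAt y z := by
    rw [emb_eq_siteAt_zero, walkEnd_siteAt]; congr 1; funext ν
    rw [Pi.add_apply, T4ReflectionCone.netDisp_replicate, hz, Function.update_apply]
    by_cases h : ν = μ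
    · subst h; simp
    · simp [h, Ne.symm h]
  have p2 : (siteAt y z).shift μ = siteAt (y.shift μ) g := by
    rw [siteAt_shift, siteAt_blockShift]; congr 1; funext ν
    rw [Pi.add_apply, Pi.add_apply, Pi.single_apply, Pi.single_apply, hz, hg, Function.update_apply, Function.update_apply]
    by_cases h : ν = μ
    · subst h; simp only [if_true, Pi.zero_apply]; omega
    · simp [h]
  have s1 := coe_holAt_walk_siteAt hj V y (List.replicate hh (μ, true)) 0 (box_replicate_true h0b μ (by simp only [Pi.zero_apply]; omega))
  rw [← emb_eq_siteAt_zero, stepExps_axis P (curv V y) (curv_self V y μ) true hh 0 (fun ρ _ => rfl), prod_map_exp_replicate_zero] at s1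
  have s2 := coe_interp_central hj V y μ
  have s3 := coe_holAt_walk_siteAt hj V (y.shift μ) (List.replicate hh (μ, true)) g
    (box_replicate_true hgb μ (by rw [hg, Function.update_self]; omega))
  rw [stepExps_axis P (curv V (y.shift μ)) (curv_self V _ μ) true hh g (fun ρ hρ => by rw [hg, Function.update_of_ne hρ]; rfl),
    prod_map_exp_replicate_zero] at s3
  rw [axialAvg_eq_holAt_walk]
  show ((holAt (interp V) (walk (emb y) (List.replicate P.L (μ, true))) : Matrix.specialUnitaryGroup (Fin 2) ℂ) : Matrix (Fin 2) (Fin 2) ℂ) = _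
  rw [hsplit, walk_append, holAt_append, p1, walk, holAt_cons, p2]
  simp only [if_true, Submonoid.coe_mul]
  have s2' : ((interp V ⟨siteAt y z, μ⟩ : Matrix.specialUnitaryGroup (Fin 2) ℂ) : Matrix (Fin 2) (Fin 2) ℂ) =
      ((V ⟨y, μ⟩ : Matrix.specialUnitaryGroup (Fin 2) ℂ) : Matrix (Fin 2) (Fin 2) ℂ) := by rw [hz]; exact s2
  rw [s1, s2', s3, one_mul, mul_one]

end Axial

end Summit.QuantumFields.YangMills.Theorems.SmoothLiftInterp

end
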